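import Literature.NumberTheory.EllipticCurves.NewformsProofs
import Literature.NumberTheory.EllipticCurves.HeckeOperatorsProofs
import Literature.NumberTheory.EllipticCurves.HeckeOperatorsAdjointProofs
import Literature.NumberTheory.EllipticCurves.Gamma1NewformLSeriesProofs
import Literature.NumberTheory.EllipticCurves.ModularCurveSturmProofs
import HarnessLib

/-!
# `S_k(Γ₀(N))^{old} ∩ S_k(Γ₀(N))^{new} = 0`: discharge of `disjoint_oldSubspace0_newSubspace0`
# (`Newforms.lean`, continued; trunk EllArithM), and strong multiplicity one from the Main Lemma

`Newforms.lean` defines the new subspace of `S_k(Γ₀(N))` *algebraically*,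
`newSubspace0 N k = ⋂_{(M,d)} ker [Γ₀(N) diag(1,d) Γ₀(M)]_k` (adjoint degeneracy maps), and the
old subspace as `oldSubspace0 N k = Σ_{(M,d)} range [Γ₀(M) diag(d,1) Γ₀(N)]_k`, and states as a
named fact (D-0014) `disjoint_oldSubspace0_newSubspace0 N k : Disjoint old new` (Atkin–Lehner
1970, Thm. 5; Diamond–Shurman §5.6: `S_k = S_k^{old} ⊕ S_k^{new}`, `S_k^{new} := (S_k^{old})^⊥`). This
file proves it (`disjoint_oldSubspace0_newSubspace0_holds`) from the Petersson theory already in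
the tree:

* `peterssonProduct_degeneracyMap0_left` — **the two degeneracy maps are adjoint**:
  `P_{Γ₀(N)}([Γ₀(M) diag(d,1) Γ₀(N)] g, f) = P_{Γ₀(M)}(g, [Γ₀(N) diag(1,d) Γ₀(M)] f)` for
  `M d ∣ N` (Li 1975, §2, Lemma 5; Diamond–Shurman Prop. 5.5.2 `[ΓαΓ']^* = [Γ'α'Γ]`,
  `α' = det(α) α⁻¹`, and Exercise 5.7.2). Proof: with `Λ = diag(1,d)⁻¹ Γ₀(N) diag(1,d) =
  Γ₀(N/d) ∩ Γ⁰(d) ≤ Γ₀(M)` (`adjLevel_le_gamma0`; it lies in `SL₂(ℤ)`, which is what makes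
  Diamond–Shurman Prop. 5.5.2(a) applicable in the tree's form `peterssonProduct_translate_adjoint`
  of `HeckeOperatorsAdjointProofs`), `P_{Γ₀(M)}(Tr_{Γ₀(M)}(f∣diag(1,d)), g) = P_Λ(f∣diag(1,d), g)`
  (trace adjunction `peterssonProduct_trace_left`, Diamond–Shurman Exercise 5.4.4),
  `P_Λ(g, f∣diag(1,d)) = P_{Γ₀(N)}(g∣diag(d,1), f)` (Prop. 5.5.2(a)) and
  `g∣diag(d,1) = [Γ₀(M) diag(d,1) Γ₀(N)] g` (`coe_degeneracyMap0'`: the trace defining the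
  degeneracy map runs over the one-point quotient `Γ₀(N) ⧸ (diag(d,1)⁻¹Γ₀(M)diag(d,1) ∩ Γ₀(N))`,
  `coe_cuspForm_trace_of_le` of `NewformsProofs`), with Hermitian symmetry
  (`peterssonProduct_conj_symm_holds`).
* `peterssonProduct_add_left`, `peterssonProduct_zero_left`, `peterssonProduct_zero_right`
  (Diamond–Shurman §5.4: sesquilinearity; convergence from `integrableOn_petersson_comp_smul_fd`).
* `disjoint_oldSubspace0_newSubspace0_holds`: for `x` old and new,
  `⟨x, x⟩ = Σᵢ ⟨[Γ₀(Mᵢ) diag(dᵢ,1) Γ₀(N)] gᵢ, x⟩ = Σᵢ ⟨gᵢ, [Γ₀(N) diag(1,dᵢ) Γ₀(Mᵢ)] x⟩ = 0`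
  (`Submodule.iSup_induction`), so `x = 0` by positivity of the Petersson product
  (`peterssonProduct_self_pos_holds` of `Gamma1NewformLSeriesProofs`, Diamond–Shurman §5.4).

With the sibling `NewformsLevelRaising` (`IsNewform0.eq_of_heckeEigenvalue_eq_of_facts`), strong
multiplicity one on `Γ₀(N)` (`IsNewform0.eq_of_heckeEigenvalue_eq`, Atkin–Lehner 1970, Thm. 4)
then only depends on the Atkin–Lehner Main Lemma `atkinLehnerMainLemma0 N k`.

## References

* A. O. L. Atkin, J. Lehner, *Hecke operators on `Γ₀(m)`*, Math. Ann. 185 (1970), Thms. 1, 4, 5.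
* W.-C. W. Li, *Newforms and functional equations*, Math. Ann. 212 (1975), §2 (Lemma 5), Thm. 3.
* F. Diamond, J. Shurman, *A first course in modular forms*, GTM 228, 2005, §5.4 (Def. 5.4.1,
  Exercise 5.4.4), §5.5 (Prop. 5.5.2), §5.6 (Def. 5.6.1, p. 188), Exercise 5.7.2.
-/

noncomputable section

open scoped MatrixGroups ModularForm ComplexConjugate

open CongruenceSubgroup UpperHalfPlane ConjAct Pointwise MeasureTheory ModularGroup
  Matrix.SpecialLinearGroup

namespace Literature.NumberTheory.EllipticCurves.ModularForms

/-! ### The adjoint level `diag(1,d)⁻¹ Γ₀(N) diag(1,d) = Γ₀(N/d) ∩ Γ⁰(d)` -/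

section AdjointLevel

variable {M N d : ℕ} [NeZero d]

/-- For `γ = (a b; c e) ∈ Γ₀(N)` and `M d ∣ N`: `γ diag(1,d) = diag(1,d) γ''` with
`γ'' = (a, db; c/d, e) ∈ Γ₀(M)`. [folklore] -/
lemma exists_mapGL_mul_tpG_eq (h : M * d ∣ N) {γ : SL(2, ℤ)} (hγ : γ ∈ Gamma0 N) :
    ∃ γ'' ∈ Gamma0 M, (mapGL ℝ γ : GL (Fin 2) ℝ) * tpG d = tpG d * mapGL ℝ γ'' := by
  obtain ⟨t, ht⟩ := dvd_entry_of_mem_Gamma0 N hγ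
  obtain ⟨s, hs⟩ := h
  let A : Matrix (Fin 2) (Fin 2) ℤ := !![γ 0 0, d * γ 0 1; M * s * t, γ 1 1]
  have h10 : γ 1 0 = d * (M * s * t) := by rw [ht, hs]; push_cast; ring
  have hdet : A.det = 1 := by
    rw [Matrix.det_fin_two_of]
    have h1 := det_entries γ
    rw [h10] at h1
    linear_combination h1
  refine ⟨⟨A, hdet⟩, by simp [Gamma0_mem, A], ?_⟩
  ext i j
  simp only [Units.val_mul, Matrix.SpecialLinearGroup.mapGL_coe_matrix, val_tpG]
  have : (γ 1 0 : ℝ) = d * (M * s * t) := by exact_mod_cast h10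
  fin_cases i <;> fin_cases j <;>
    simp [Matrix.mul_apply, Fin.sum_univ_two, A, this] <;> ring

/-- The level `Λ_d = diag(1,d)⁻¹ Γ₀(N) diag(1,d)` of `f ∣[k] diag(1,d)` for `f ∈ S_k(Γ₀(N))` (the
group `{(a, db; c/d, e)} = Γ₀(N/d) ∩ Γ⁰(d)`) is contained in `Γ₀(M)` for `M d ∣ N`; it is written
with `glCast (diagGL 1 d)` so that the `IsArithmetic`/`HasDetOne` instances of `HeckeOperators`
apply. [folklore] -/
lemma adjLevel_le_gamma0 (h : M * d ∣ N) :
    (toConjAct (glCast (diagGL 1 d one_pos (Nat.cast_pos.mpr (NeZero.pos d)) : GL (Fin 2) ℚ))⁻¹ •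
      ((Gamma0 N : Subgroup SL(2, ℤ)) : Subgroup (GL (Fin 2) ℝ))) ≤
      ((Gamma0 M : Subgroup SL(2, ℤ)) : Subgroup (GL (Fin 2) ℝ)) := by
  intro x hx
  rw [toConjAct_inv, Subgroup.mem_inv_pointwise_smul_iff, ConjAct.smul_def,
    ConjAct.ofConjAct_toConjAct] at hx
  obtain ⟨γ, hγ, hγx⟩ := hx
  obtain ⟨γ'', hγ'', hmul⟩ := exists_mapGL_mul_tpG_eq h hγ
  -- `x = tpG⁻¹ γ tpG = γ''`
  have hx' : x = (tpG d)⁻¹ * (mapGL ℝ γ : GL (Fin 2) ℝ) * tpG d := by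
    rw [hγx]; change x = (tpG d)⁻¹ * (tpG d * x * (tpG d)⁻¹) * tpG d; group
  rw [hx', mul_assoc, hmul, ← mul_assoc, inv_mul_cancel, one_mul]
  exact ⟨γ'', hγ'', rfl⟩

/-- `Λ_d ≤ 𝒮ℒ` (it consists of integral matrices since `d ∣ N ∣ c`). [folklore] -/
lemma adjLevel_le_SL (h : M * d ∣ N) :
    (toConjAct (glCast (diagGL 1 d one_pos (Nat.cast_pos.mpr (NeZero.pos d)) : GL (Fin 2) ℚ))⁻¹ •
      ((Gamma0 N : Subgroup SL(2, ℤ)) : Subgroup (GL (Fin 2) ℝ))) ≤ 𝒮ℒ :=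
  (adjLevel_le_gamma0 h).trans (Subgroup.map_le_range _ _)

end AdjointLevel

/-! ### The degeneracy maps are adjoint (Li 1975, Lemma 5; Diamond–Shurman Prop. 5.5.2) -/

section Adjoint

/-- The Petersson product only depends on the level as a subgroup and on the underlying functions:
transport along an equality of levels. [folklore] -/
lemma peterssonProduct_congr {Γ₁ Γ₂ : Subgroup (GL (Fin 2) ℝ)} [Γ₁.IsArithmetic] [Γ₁.HasDetOne]
    [Γ₂.IsArithmetic] [Γ₂.HasDetOne] (k : ℤ) (hΓ : Γ₁ = Γ₂) (F₁ G₁ : CuspForm Γ₁ k)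
    (F₂ G₂ : CuspForm Γ₂ k) (hF : (⇑F₁ : ℍ → ℂ) = ⇑F₂) (hG : (⇑G₁ : ℍ → ℂ) = ⇑G₂) :
    peterssonProduct Γ₁ k F₁ G₁ = peterssonProduct Γ₂ k F₂ G₂ := by
  subst hΓ
  obtain rfl : F₁ = F₂ := DFunLike.ext' hF
  obtain rfl : G₁ = G₂ := DFunLike.ext' hG
  rfl

variable (M N d : ℕ) [NeZero M] [NeZero N] [NeZero d] (k : ℤ) (h : M * d ∣ N)

include h in
/-- The degeneracy map `degeneracyMap0 M N d k = [Γ₀(M) diag(d,1) Γ₀(N)]` of `Newforms.lean` is,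
for `M d ∣ N`, the single term `g ∣[k] diag(d,1)`: `diag(d,1) Γ₀(N) diag(d,1)⁻¹ ⊆ Γ₀(M)`
(`(a b; c e) ↦ (a, db; c/d, e)`), so Mathlib's trace runs over a one-point quotient
(`coe_cuspForm_trace_of_le` of `NewformsProofs`; Diamond–Shurman §5.1 case (1), §5.6 `[α_d]_k`). [folklore] -/
theorem coe_degeneracyMap0' (g : CuspForm (Gamma0 M) k) :
    (⇑(degeneracyMap0 M N d k g) : ℍ → ℂ) =
      ⇑g ∣[k] glCast (diagGL d 1 (Nat.cast_pos.mpr (NeZero.pos d)) one_pos : GL (Fin 2) ℚ) := by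
  -- `Γ₀(N) ≤ diag(d,1)⁻¹ Γ₀(M) diag(d,1)`
  have hle : ((Gamma0 N : Subgroup SL(2, ℤ)) : Subgroup (GL (Fin 2) ℝ)) ≤
      toConjAct (glCast (diagGL d 1 (Nat.cast_pos.mpr (NeZero.pos d)) one_pos : GL (Fin 2) ℚ))⁻¹ •
        ((Gamma0 M : Subgroup SL(2, ℤ)) : Subgroup (GL (Fin 2) ℝ)) := by
    rintro x ⟨γ, hγ, rfl⟩
    rw [toConjAct_inv, Subgroup.mem_inv_pointwise_smul_iff, ConjAct.smul_def,
      ConjAct.ofConjAct_toConjAct]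
    obtain ⟨t, ht⟩ := dvd_entry_of_mem_Gamma0 N hγ
    obtain ⟨s, hs⟩ := h
    let A : Matrix (Fin 2) (Fin 2) ℤ := !![γ 0 0, d * γ 0 1; M * s * t, γ 1 1]
    have h10 : γ 1 0 = d * (M * s * t) := by rw [ht, hs]; push_cast; ring
    have hdet : A.det = 1 := by
      rw [Matrix.det_fin_two_of]
      have h1 := det_entries γ
      rw [h10] at h1
      linear_combination h1
    have hmul : tpD d * (mapGL ℝ γ : GL (Fin 2) ℝ) = mapGL ℝ (⟨A, hdet⟩ : SL(2, ℤ)) * tpD d := by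
      ext i j
      simp only [Units.val_mul, Matrix.SpecialLinearGroup.mapGL_coe_matrix, val_tpD]
      have : (γ 1 0 : ℝ) = d * (M * s * t) := by exact_mod_cast h10
      fin_cases i <;> fin_cases j <;>
        simp [Matrix.mul_apply, Fin.sum_univ_two, A, this] <;> ring
    refine ⟨⟨A, hdet⟩, by simp [Gamma0_mem, A], ?_⟩
    change _ = tpD d * (mapGL ℝ γ : GL (Fin 2) ℝ) * (tpD d)⁻¹
    rw [hmul, mul_inv_cancel_right]
  change ⇑(CuspForm.trace _ (CuspForm.translate g
    (glCast (diagGL d 1 (Nat.cast_pos.mpr (NeZero.pos d)) one_pos : GL (Fin 2) ℚ)))) = _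
  rw [coe_cuspForm_trace_of_le _ hle]
  rfl

include h in
/-- **The degeneracy map and the adjoint degeneracy map are adjoint for the Petersson product**:
for `M d ∣ N`, `g ∈ S_k(Γ₀(M))`, `f ∈ S_k(Γ₀(N))`,
`P_{Γ₀(N)}([Γ₀(M) diag(d,1) Γ₀(N)] g, f) = P_{Γ₀(M)}(g, [Γ₀(N) diag(1,d) Γ₀(M)] f)`
(Li 1975, §2, Lemma 5; Diamond–Shurman Prop. 5.5.2 and Exercise 5.7.2: `[ΓαΓ']^* = [Γ'α'Γ]`,
`α' = det(α)α⁻¹`). Proof: with `Λ = diag(1,d)⁻¹Γ₀(N)diag(1,d) ≤ Γ₀(M)`,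
`P_{Γ₀(M)}(Tr_{Γ₀(M)}(f∣diag(1,d)), g) = P_Λ(f∣diag(1,d), g)` (trace adjunction,
`peterssonProduct_trace_left`) and `P_Λ(g, f∣diag(1,d)) = P_{Γ₀(N)}(g∣diag(d,1), f)`
(`peterssonProduct_translate_adjoint`, Diamond–Shurman Prop. 5.5.2(a)), plus Hermitian symmetry. [cite: DiamondShurman2005, Prop. 5.5.2] -/
theorem peterssonProduct_degeneracyMap0_left (g : CuspForm (Gamma0 M) k) (f : CuspForm (Gamma0 N) k) :
    peterssonProduct (Gamma0 N) k (degeneracyMap0 M N d k g) f =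
      peterssonProduct (Gamma0 M) k g (adjDegeneracyMap0 N M d k f) := by
  set αG : GL(2, ℚ)⁺ := diagGL 1 d one_pos (Nat.cast_pos.mpr (NeZero.pos d)) with hαG
  set αD : GL(2, ℚ)⁺ := diagGL d 1 (Nat.cast_pos.mpr (NeZero.pos d)) one_pos with hαD
  have hadj : ((αD : GL (Fin 2) ℚ) : Matrix (Fin 2) (Fin 2) ℚ) =
      ((αG : GL (Fin 2) ℚ) : Matrix (Fin 2) (Fin 2) ℚ).adjugate :=
    coe_coe_diagGL_eq_adjugate 1 d one_pos (Nat.cast_pos.mpr (NeZero.pos d))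
  set Λ : Subgroup (GL (Fin 2) ℝ) := toConjAct (glCast (αG : GL (Fin 2) ℚ))⁻¹ •
      ((Gamma0 N : Subgroup SL(2, ℤ)) : Subgroup (GL (Fin 2) ℝ)) with hΛdef
  have hΛM : Λ ≤ ((Gamma0 M : Subgroup SL(2, ℤ)) : Subgroup (GL (Fin 2) ℝ)) :=
    adjLevel_le_gamma0 (M := M) (N := N) (d := d) h
  have hΛSL : Λ ≤ 𝒮ℒ := adjLevel_le_SL (M := M) (N := N) (d := d) h
  have hNSL : ((Gamma0 N : Subgroup SL(2, ℤ)) : Subgroup (GL (Fin 2) ℝ)) ≤ 𝒮ℒ :=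
    Subgroup.map_le_range _ _
  have hMSL : ((Gamma0 M : Subgroup SL(2, ℤ)) : Subgroup (GL (Fin 2) ℝ)) ≤ 𝒮ℒ :=
    Subgroup.map_le_range _ _
  -- the forms on `Λ = adjLevel N d`: `F₁ = f ∣ diag(1,d)`, `G' = g`
  set F₁ : CuspForm Λ k := CuspForm.translate f (glCast (αG : GL (Fin 2) ℚ)) with hF₁
  obtain ⟨G', hG'⟩ := exists_cuspForm_coe_eq_of_le hΛM g
  -- Prop. 5.5.2(a): `P_Λ(G', F₁) = P_{Γ₀(N)}(degeneracyMap0 g, f)`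
  have step1 : peterssonProduct Λ k G' F₁ =
      peterssonProduct (Gamma0 N) k (degeneracyMap0 M N d k g) f :=
    peterssonProduct_translate_adjoint _ hNSL k αG αD hadj Λ rfl hΛSL f G' F₁
      (degeneracyMap0 M N d k g) rfl (by rw [hG']; exact coe_degeneracyMap0' M N d k h g)
  -- trace adjunction: `P_{Γ₀(M)}(adj f, g) = P_{Λ ⊓ Γ₀(M)}(F₁, g)`
  obtain ⟨H₁, hH₁⟩ := exists_cuspForm_coe_eq_of_le
    (Γ' := Λ ⊓ ((Gamma0 M : Subgroup SL(2, ℤ)) : Subgroup (GL (Fin 2) ℝ)))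
    inf_le_left F₁
  obtain ⟨G₁, hG₁⟩ := exists_cuspForm_coe_eq_of_le
    (Γ' := Λ ⊓ ((Gamma0 M : Subgroup SL(2, ℤ)) : Subgroup (GL (Fin 2) ℝ)))
    inf_le_right g
  have step2 : peterssonProduct (Gamma0 M) k (adjDegeneracyMap0 N M d k f) g =
      peterssonProduct _ k H₁ G₁ :=
    peterssonProduct_trace_left k hMSL F₁ g H₁ G₁ hH₁ hG₁
  -- `Λ ⊓ Γ₀(M) = Λ`
  have step3 : peterssonProduct _ k H₁ G₁ = peterssonProduct Λ k F₁ G' :=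
    peterssonProduct_congr k (inf_eq_left.mpr hΛM) H₁ G₁ F₁ G' hH₁ (by rw [hG₁, hG'])
  rw [← step1, peterssonProduct_conj_symm_holds _ k F₁ G', ← step3, ← step2,
    ← peterssonProduct_conj_symm_holds]

end Adjoint


/-! ### Additivity of the Petersson product in the first variable -/

section Additive

variable (Γ : Subgroup (GL (Fin 2) ℝ)) [Γ.IsArithmetic] [Γ.HasDetOne] (k : ℤ)

/-- The Petersson integrand is additive in the first variable. [folklore] -/
lemma petersson_add_left (f₁ f₂ g : ℍ → ℂ) (τ : ℍ) :
    petersson k (f₁ + f₂) g τ = petersson k f₁ g τ + petersson k f₂ g τ := by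
  simp [petersson, add_mul]

/-- **Additivity of the Petersson product in the first variable** (Diamond–Shurman §5.4, after
Def. 5.4.1: the product is (conjugate-)linear in each variable); convergence from
`integrableOn_petersson_comp_smul_fd`. [cite: DiamondShurman2005, §5.4 (after Def. 5.4.1)] -/
theorem peterssonProduct_add_left (f₁ f₂ g : CuspForm Γ k) :
    peterssonProduct Γ k (f₁ + f₂) g = peterssonProduct Γ k f₁ g + peterssonProduct Γ k f₂ g := by
  letI : Fintype (𝒮ℒ ⧸ Γ.subgroupOf 𝒮ℒ) := Fintype.ofFinite _
  rw [peterssonProduct_eq_setIntegral Γ k, peterssonProduct_eq_setIntegral Γ k,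
    peterssonProduct_eq_setIntegral Γ k, ← integral_add]
  · refine setIntegral_congr_fun isClosed_fd.measurableSet fun τ _ ↦ ?_
    simp only [← Finset.sum_add_distrib, CuspForm.coe_add, petersson_add_left]
  · exact integrable_finsetSum _ fun q _ ↦ integrableOn_petersson_comp_smul_fd k f₁ g (q.out).2
  · exact integrable_finsetSum _ fun q _ ↦ integrableOn_petersson_comp_smul_fd k f₂ g (q.out).2

/-- `P(0, g) = 0`. [folklore] -/
theorem peterssonProduct_zero_left (g : CuspForm Γ k) : peterssonProduct Γ k 0 g = 0 := by
  have h := peterssonProduct_add_left Γ k 0 0 g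
  rw [add_zero] at h
  linear_combination -h

end Additive


/-! ### `old ∩ new = 0` -/

section OldNew

variable (N : ℕ) [NeZero N] (k : ℤ)

/-- `P(g, 0) = 0`. [folklore] -/
theorem peterssonProduct_zero_right {Γ : Subgroup (GL (Fin 2) ℝ)} [Γ.IsArithmetic] [Γ.HasDetOne]
    (k : ℤ) (g : CuspForm Γ k) : peterssonProduct Γ k g 0 = 0 := by
  rw [peterssonProduct_conj_symm_holds Γ k 0 g, peterssonProduct_zero_left, map_zero]

/-- **Discharge of `disjoint_oldSubspace0_newSubspace0`** (`Newforms.lean`; Atkin–Lehner 1970,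
Thm. 5, Diamond–Shurman §5.6 p. 188: `S_k = S_k^{old} ⊕ S_k^{new}` with `S_k^{new} = (S_k^{old})^⊥`):
for the *kernel-defined* new subspace `newSubspace0 N k = ⋂ ker [Γ₀(N) diag(1,d) Γ₀(M)]` the
intersection with `oldSubspace0 N k = Σ range [Γ₀(M) diag(d,1) Γ₀(N)]` is `0`. Proof: for
`x` old and new, `⟨x, x⟩ = Σᵢ ⟨[Γ₀(Mᵢ) diag(dᵢ,1) Γ₀(N)] gᵢ, x⟩ = Σᵢ ⟨gᵢ, [Γ₀(N) diag(1,dᵢ) Γ₀(Mᵢ)] x⟩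
= 0` by the adjointness `peterssonProduct_degeneracyMap0_left` (Li 1975, Lemma 5 /
Diamond–Shurman Prop. 5.5.2, Exercise 5.7.2), and the Petersson product is positive definite
(`peterssonProduct_self_pos_holds`, Diamond–Shurman §5.4). [cite: AtkinLehner1970, Thm. 5] -/
theorem disjoint_oldSubspace0_newSubspace0_holds : disjoint_oldSubspace0_newSubspace0 N k := by
  rw [disjoint_oldSubspace0_newSubspace0, Submodule.disjoint_def]
  intro x hold hnew
  have hadj : ∀ Md : DegeneracyIndex N, adjDegeneracyMap0 N Md.1.1 Md.1.2 k x = 0 := fun Md ↦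
    LinearMap.mem_ker.mp ((Submodule.mem_iInf _).mp hnew Md)
  have hP : peterssonProduct (Gamma0 N) k x x = 0 := by
    refine Submodule.iSup_induction
      (fun Md : DegeneracyIndex N ↦ LinearMap.range (degeneracyMap0 Md.1.1 N Md.1.2 k))
      (motive := fun y ↦ peterssonProduct (Gamma0 N) k y x = 0) hold ?_ ?_ ?_
    · rintro Md y ⟨g, rfl⟩
      rw [peterssonProduct_degeneracyMap0_left Md.1.1 N Md.1.2 k Md.2.2 g x, hadj Md,
        peterssonProduct_zero_right]
    · exact peterssonProduct_zero_left _ k x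
    · intro y z hy hz
      rw [peterssonProduct_add_left, hy, hz, add_zero]
  by_contra hx
  have hpos := peterssonProduct_self_pos_holds (Gamma0 N : Subgroup (GL (Fin 2) ℝ)) k hx
  rw [hP, Complex.zero_re] at hpos
  exact lt_irrefl _ hpos

end OldNew

/-! ### `old + new = ⊤` (restored 2026-08-14)

`oldSubspace0_sup_newSubspace0_holds` was part of proposal p11375 of this file (lost to a gate
restart) and is used by `NewformsStrongMultiplicityOne`; the linear algebra
(`sup_eq_top_of_orthogonal_le`) and the assembly are that proposal's, with definiteness taken from
`peterssonProduct_self_pos_holds`. -/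

section LinearAlgebra

variable {V : Type*} [AddCommGroup V] [Module ℂ V] [FiniteDimensional ℂ V]

/-- **A subspace and its right orthogonal span a finite-dimensional space**, for a form
`B : V → V → ℂ` that is additive and conjugate-homogeneous in the first variable, linear in the
second, and *definite* (`B v v = 0 → v = 0`): if `W' ⊇ {v | ∀ w ∈ W, B w v = 0}` then
`W ⊔ W' = ⊤`. Proof by counting dimensions: the right orthogonal `U` of `W` is the kernel of
`v ↦ (B wᵢ v)ᵢ` for a basis `w₁, …, w_m` of `W`, so `dim U ≥ dim V - m`, and `W ⊓ U = 0` by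
definiteness (the finite-dimensional linear algebra behind Diamond–Shurman Def. 5.6.1,
`S_k = S_k^old ⊕ (S_k^old)^⊥`). [folklore] -/
theorem sup_eq_top_of_orthogonal_le (B : V → V → ℂ)
    (add_left : ∀ u v w, B (u + v) w = B u w + B v w)
    (smul_left : ∀ (c : ℂ) v w, B (c • v) w = conj c * B v w)
    (add_right : ∀ u v w, B u (v + w) = B u v + B u w)
    (smul_right : ∀ (c : ℂ) v w, B v (c • w) = c * B v w)
    (definite : ∀ v, B v v = 0 → v = 0) (W W' : Submodule ℂ V)
    (hW' : ∀ v, (∀ w ∈ W, B w v = 0) → v ∈ W') : W ⊔ W' = ⊤ := by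
  classical
  -- `B w` as a linear functional
  let L : V → V →ₗ[ℂ] ℂ := fun w ↦
    { toFun := B w
      map_add' := add_right w
      map_smul' := fun c v ↦ by rw [smul_right, RingHom.id_apply, smul_eq_mul] }
  have hL : ∀ w v, L w v = B w v := fun _ _ ↦ rfl
  -- the right orthogonal `U` of `W`
  let U : Submodule ℂ V := ⨅ w : W, LinearMap.ker (L (w : V))
  have hU : ∀ v, v ∈ U ↔ ∀ w ∈ W, B w v = 0 := fun v ↦ by
    simp only [U, Submodule.mem_iInf, LinearMap.mem_ker, hL, Subtype.forall]
  have hUW' : U ≤ W' := fun v hv ↦ hW' v ((hU v).1 hv)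
  suffices h : W ⊔ U = ⊤ by
    exact eq_top_iff.mpr (h ▸ sup_le_sup_left hUW' W)
  -- `U` is the kernel of `Φ : v ↦ (B bᵢ v)ᵢ` for a basis `b` of `W`
  set m := Module.finrank ℂ W with hm
  let b := Module.finBasis ℂ W
  let Φ : V →ₗ[ℂ] (Fin m → ℂ) := LinearMap.pi fun i ↦ L (b i : V)
  have hker : LinearMap.ker Φ = U := by
    ext v
    simp only [Φ, LinearMap.mem_ker, hU]
    constructor
    · intro h w hw
      have hi : ∀ i, B (b i : V) v = 0 := fun i ↦ by
        simpa [hL] using congr_fun h i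
      have hw' : (w : V) = ∑ i, b.repr ⟨w, hw⟩ i • (b i : V) := by
        have := congrArg Subtype.val (b.sum_repr ⟨w, hw⟩)
        rw [Submodule.coe_sum] at this
        simp only [Submodule.coe_smul] at this
        exact this.symm
      rw [hw']
      have hsum : ∀ (s : Finset (Fin m)),
          B (∑ i ∈ s, b.repr ⟨w, hw⟩ i • (b i : V)) v = 0 := by
        intro s
        induction s using Finset.induction_on with
        | empty =>
          have h0 : B (0 : V) v = 0 := by
            have := smul_left 0 (0 : V) v
            rwa [zero_smul, map_zero, zero_mul] at this
          simpa using h0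
        | insert a s ha ih =>
          rw [Finset.sum_insert ha, add_left, smul_left, hi a, mul_zero, zero_add, ih]
      exact hsum Finset.univ
    · intro h
      funext i
      simpa [hL] using h _ (b i).2
  have h1 : Module.finrank ℂ (LinearMap.range Φ) + Module.finrank ℂ U = Module.finrank ℂ V := by
    rw [← hker]
    exact LinearMap.finrank_range_add_finrank_ker Φ
  have h2 : Module.finrank ℂ (LinearMap.range Φ) ≤ m :=
    (Submodule.finrank_le _).trans (by simp)
  have h3 : W ⊓ U = ⊥ := by
    rw [eq_bot_iff]
    intro v hv
    rw [Submodule.mem_bot]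
    exact definite v ((hU v).1 hv.2 v hv.1)
  have h4 := Submodule.finrank_sup_add_finrank_inf_eq W U
  rw [h3, finrank_bot, add_zero] at h4
  apply Submodule.eq_top_of_finrank_eq
  refine le_antisymm (Submodule.finrank_le _) ?_
  omega

end LinearAlgebra

section SupTop

variable (N : ℕ) [NeZero N] (k : ℤ)

/-- **Additivity of the Petersson product in the second variable** (Diamond–Shurman §5.4, after
Def. 5.4.1), from `peterssonProduct_add_left` by Hermitian symmetry. [cite: DiamondShurman2005, §5.4 (after Def. 5.4.1)] -/
theorem peterssonProduct_add_right {Γ : Subgroup (GL (Fin 2) ℝ)} [Γ.IsArithmetic] [Γ.HasDetOne]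
    (k : ℤ) (f g₁ g₂ : CuspForm Γ k) :
    peterssonProduct Γ k f (g₁ + g₂) = peterssonProduct Γ k f g₁ + peterssonProduct Γ k f g₂ := by
  rw [peterssonProduct_conj_symm_holds Γ k (g₁ + g₂) f, peterssonProduct_add_left, map_add,
    ← peterssonProduct_conj_symm_holds Γ k g₁ f, ← peterssonProduct_conj_symm_holds Γ k g₂ f]

/-- **The Petersson product is definite**: `P_Γ(f, f) = 0` forces `f = 0` (Diamond–Shurman §5.4,
after Def. 5.4.1; from positivity `peterssonProduct_self_pos_holds`). [cite: DiamondShurman2005, §5.4 (after Def. 5.4.1)] -/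
theorem eq_zero_of_peterssonProduct_self_eq_zero {Γ : Subgroup (GL (Fin 2) ℝ)} [Γ.IsArithmetic]
    [Γ.HasDetOne] (k : ℤ) (f : CuspForm Γ k) (h : peterssonProduct Γ k f f = 0) : f = 0 := by
  by_contra hf
  have hpos := peterssonProduct_self_pos_holds Γ k hf
  rw [h, Complex.zero_re] at hpos
  exact lt_irrefl _ hpos

/-- **The (right) Petersson orthogonal of the old subspace lies in the algebraic new subspace**:
if `P(f, g) = 0` for all oldforms `f`, then every adjoint degeneracy map kills `g`, since
`P_M(ι†g, ι†g) = P_N(ι ι†g, g) = 0` (adjointness `peterssonProduct_degeneracyMap0_left`) and the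
Petersson product of level `Γ₀(M)` is definite (`eq_zero_of_peterssonProduct_self_eq_zero`).
(Diamond–Shurman Def. 5.6.1 defines the new subspace as this orthogonal complement.) [cite: DiamondShurman2005, Def. 5.6.1] -/
theorem mem_newSubspace0_of_forall_peterssonProduct_eq_zero {g : CuspForm (Gamma0 N) k}
    (hg : ∀ f ∈ oldSubspace0 N k, peterssonProduct (Gamma0 N) k f g = 0) :
    g ∈ newSubspace0 N k := by
  rw [newSubspace0, Submodule.mem_iInf]
  intro Md
  rw [LinearMap.mem_ker]
  apply eq_zero_of_peterssonProduct_self_eq_zero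
  rw [← peterssonProduct_degeneracyMap0_left Md.1.1 N Md.1.2 k Md.2.2]
  apply hg
  rw [oldSubspace0]
  exact Submodule.mem_iSup_of_mem Md (LinearMap.mem_range_self _ _)

/-- **Discharge of `oldSubspace0_sup_newSubspace0`** (`Newforms.lean`):
**`S_k(Γ₀(N)) = S_k(Γ₀(N))^old + S_k(Γ₀(N))^new`** (spanning part of the old/new decomposition;
Atkin–Lehner 1970, Thm. 5; Diamond–Shurman Def. 5.6.1, p. 188–189, where
`S_k^new := (S_k^old)^⊥` for the Petersson product, which is positive definite, §5.4, on the
finite-dimensional space `S_k`). With the algebraic `newSubspace0` of this library: the right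
orthogonal of `oldSubspace0` lies in `newSubspace0`
(`mem_newSubspace0_of_forall_peterssonProduct_eq_zero`), and a subspace plus its orthogonal is
everything for a definite sesquilinear form on a finite-dimensional space
(`sup_eq_top_of_orthogonal_le`; `finiteDimensional_cuspForm_gamma0`,
`eq_zero_of_peterssonProduct_self_eq_zero`). [cite: AtkinLehner1970, Thm. 5]
[cite: DiamondShurman2005, Def. 5.6.1] -/
theorem oldSubspace0_sup_newSubspace0_holds : oldSubspace0_sup_newSubspace0 N k := by
  haveI : FiniteDimensional ℂ (CuspForm (Gamma0 N) k) := finiteDimensional_cuspForm_gamma0 N k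
  unfold oldSubspace0_sup_newSubspace0
  exact sup_eq_top_of_orthogonal_le (peterssonProduct (Gamma0 N) k)
    (peterssonProduct_add_left _ k) (peterssonProduct_smul_left _ k)
    (peterssonProduct_add_right k) (peterssonProduct_smul_right _ k)
    (eq_zero_of_peterssonProduct_self_eq_zero k) (oldSubspace0 N k) (newSubspace0 N k)
    fun _ hg ↦ mem_newSubspace0_of_forall_peterssonProduct_eq_zero N k hg

end SupTop

end Literature.NumberTheory.EllipticCurves.ModularForms
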